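import Mathlib
import Summits.Ventures.PercRepro.TriangleCapBandLocusLevel
import Summits.Ventures.PercRepro.TriangleCapLayerWitnessValue

/-!
# PercRepro — THE EXACT TOP OF THE PAIR-COUNT SPECTRUM, AND THE FIRST `T` LAYERS OF THE CHERRY TABLE FOR
EVERY `T` (p3, gen 51; part 232)

`pair_count_spectrum_exact` (`4 T + 3 ≤ s`, `2 s ≥ 4 T + 6 + T (T + 1)`): the values of `Σ d²` over the triangle-free
graphs with `s` edges that lie ABOVE the level-`T` tail `s (s + 1) − 2 (T + 1)(s − T − 2)` are EXACTLY the band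
values `s (s + 1) − 2 t (s − t − 1) − 2 j`, `t ≤ T`, `2 j ≤ t (t + 1)` — every graph above the tail sits in a band
(`pair_count_spectrum_level`), every band value lies above the tail (`band_bottom_lt_tail`, the bands being
disjoint), and every band value is attained (`pair_count_band_attained`; the star for `t = 0`).  So the top of the
spectrum is `1 + 2 + 4 + 7 + 11 + 16 + …` values in layers of `t (t + 1) / 2 + 1`.

On the cell (`cherry_top_layers`, `T + 1 ≤ a`, `4 T + 3 ≤ r`, `2 r ≥ 4 T + 6 + T (T + 1)`, `2 a + r ≤ k`,
`2 (T + 1)(r − T − 2) ≤ stabGapFull k a r`): THE FIRST `T` LAYERS OF THE CHERRY TABLE ARE COMPLETE FOR EVERY `T` — a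
`K₄⁻`-free graph strictly within `2 (T + 1)(r − T − 2)` of the closed form sits at a band value
`closed − (2 t (r − t − 1) + 2 j)`, `t ≤ T`, and every such value is attained.  The instances `T = 5`
(`pair_count_spectrum_five`, `s ≥ 28`; `fifth_band_locus`, `j ≤ 15`; `cherry_fifth_band_locus`;
`cherry_top_five_layers`: the forty-one values) extend the top twenty-five of part 228 by the fifth band.
Axioms: standard.
-/

namespace PercRepro

namespace TriangleCap

namespace C047

open Finset

variable {V : Type*} [Fintype V] [DecidableEq V]

/-- The band `T` lies strictly above the level-`T` tail: `2 T (s − T − 1) + T (T + 1) < 2 (T + 1)(s − T − 2)` for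
`2 s ≥ 4 T + 6 + T (T + 1)`. -/
theorem band_bottom_lt_tail (s T : ℕ) (hs : 4 * T + 6 + T * (T + 1) ≤ 2 * s) :
    2 * (T * (s - T - 1)) + T * (T + 1) < 2 * ((T + 1) * (s - T - 2)) := by
  obtain ⟨v, rfl⟩ : ∃ v, s = T + 2 + v := ⟨s - T - 2, by omega⟩
  have e1 : T + 2 + v - T - 1 = v + 1 := by omega
  have e2 : T + 2 + v - T - 2 = v := by omega
  rw [e1, e2]
  nlinarith

/-- Every band `t ≤ T` lies strictly above the level-`T` tail. -/
theorem band_lt_tail (s T t j : ℕ) (ht : t ≤ T) (hs : 4 * T + 6 + T * (T + 1) ≤ 2 * s) (hj : 2 * j ≤ t * (t + 1)) :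
    2 * (t * (s - t - 1)) + 2 * j < 2 * ((T + 1) * (s - T - 2)) := by
  have h1 := band_bottom_lt_tail s T hs
  rcases Nat.lt_or_ge t T with hlt | hge
  · have h2 := band_bottom_lt s T t hlt hs
    omega
  · have : t = T := by omega
    subst this
    omega

/-- **THE STAR VALUE IS ATTAINED:** a triangle-free graph with `s ≥ 1` edges on `s + 1` vertices and
`Σ d² = s (s + 1)` (the missing graph of `bipMinusStar (s + 1) 1 s`). -/
theorem pair_count_star_attained (s : ℕ) (hs : 1 ≤ s) :
    ∃ (H : SimpleGraph (Fin (s + 1))) (_ : DecidableRel H.Adj), H.CliqueFree 3 ∧ H.edgeFinset.card = s ∧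
      ∑ v, deg H v * deg H v = s * (s + 1) := by
  have hB : BipSub (bipMinusStar (s + 1) 1 s) (leftPart (s + 1) 1) := fun x y h =>
    bipMinusStar_bipartite (s + 1) 1 s x y h
  have hE := card_edges_bipMinusStar (s + 1) 1 s le_rfl (by omega)
  have hS := sum_deg_sq_bipMinusStar (s + 1) 1 s le_rfl (by omega) (by omega)
  rw [Fintype.card_fin] at hS
  have hbs := bipSub_sum_deg_sq_add_disjEdgePairs (bipMinusStar (s + 1) 1 s) (leftPart (s + 1) 1) hB 1 s
    (card_leftPart (s + 1) 1 (by omega)) (by rw [Fintype.card_fin]; exact hE) (by rw [Fintype.card_fin])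
  rw [Fintype.card_fin] at hbs
  have hr := card_edges_missingGraph (bipMinusStar (s + 1) 1 s) (leftPart (s + 1) 1) hB 1 s
    (card_leftPart (s + 1) 1 (by omega)) (by rw [Fintype.card_fin]; exact hE)
  have hid := sum_deg_sq_add_disjEdgePairs (missingGraph (bipMinusStar (s + 1) 1 s) (leftPart (s + 1) 1))
  rw [hr] at hid
  refine ⟨missingGraph (bipMinusStar (s + 1) 1 s) (leftPart (s + 1) 1), inferInstance,
    cliqueFree_of_bipSub _ _ (bipSub_missingGraph _ _), hr, ?_⟩
  omega

/-- **THE EXACT TOP OF THE PAIR-COUNT SPECTRUM** (`4 T + 3 ≤ s`, `2 s ≥ 4 T + 6 + T (T + 1)`): (i) every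
triangle-free graph with `s` edges above the level-`T` tail sits in a band `t ≤ T`; (ii) every band value `t ≤ T`,
`2 j ≤ t (t + 1)` lies above the tail and is attained by a triangle-free graph with `s` edges on `s + t + 1`
vertices. -/
theorem pair_count_spectrum_exact (T s : ℕ) (hs4 : 4 * T + 3 ≤ s) (hs : 4 * T + 6 + T * (T + 1) ≤ 2 * s) :
    (∀ (H : SimpleGraph V) [DecidableRel H.Adj], H.CliqueFree 3 → H.edgeFinset.card = s →
        s * (s + 1) < ∑ v, deg H v * deg H v + 2 * ((T + 1) * (s - T - 2)) →
        ∃ t, t ≤ T ∧ ∃ j, 2 * j ≤ t * (t + 1) ∧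
          ∑ v, deg H v * deg H v + 2 * (t * (s - t - 1)) + 2 * j = s * (s + 1)) ∧
      (∀ t, t ≤ T → ∀ j, 2 * j ≤ t * (t + 1) →
        2 * (t * (s - t - 1)) + 2 * j < 2 * ((T + 1) * (s - T - 2)) ∧
        ∃ (H : SimpleGraph (Fin (s + t + 1))) (_ : DecidableRel H.Adj), H.CliqueFree 3 ∧ H.edgeFinset.card = s ∧
          ∑ v, deg H v * deg H v + 2 * (t * (s - t - 1)) + 2 * j = s * (s + 1)) := by
  refine ⟨?_, ?_⟩
  · intro H _ hfree hm hlt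
    rcases pair_count_spectrum_level H hfree T s hs4 hm with h | h
    · exact h
    · omega
  · intro t ht j hj
    refine ⟨band_lt_tail s T t j ht hs hj, ?_⟩
    rcases Nat.eq_zero_or_pos t with rfl | hpos
    · have hj0 : j = 0 := by omega
      subst hj0
      obtain ⟨H, inst, hfree, hE, hS⟩ := pair_count_star_attained s (by omega)
      exact ⟨H, inst, hfree, hE, by simpa using hS⟩
    · exact pair_count_band_attained s t j hpos (by omega) hj

/-- **THE FIRST `T` LAYERS OF THE CHERRY TABLE ARE COMPLETE, FOR EVERY `T`** (`3 ≤ a`, `T + 1 ≤ a`, `4 T + 3 ≤ r`,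
`2 r ≥ 4 T + 6 + T (T + 1)`, `2 a + r ≤ k` (`r + 7 ≤ k` at `a = 3`), `2 (T + 1)(r − T − 2) ≤ stabGapFull k a r`):
(i) a `K₄⁻`-free graph strictly within `2 (T + 1)(r − T − 2)` of the closed form sits at a band value
`closed − (2 t (r − t − 1) + 2 j)` with `t ≤ T`, `2 j ≤ t (t + 1)`; (ii) every such value is attained. -/
theorem cherry_top_layers (k a r T : ℕ) (ha3 : 3 ≤ a) (ha : T + 1 ≤ a) (hr4 : 4 * T + 3 ≤ r)
    (hr : 4 * T + 6 + T * (T + 1) ≤ 2 * r) (hk : 2 * a + r ≤ k) (hk3 : a = 3 → r + 7 ≤ k)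
    (hgap : 2 * ((T + 1) * (r - T - 2)) ≤ stabGapFull k a r) :
    (∀ (D : SimpleGraph (Fin k)) [DecidableRel D.Adj], K4mFree D → D.edgeFinset.card + r = a * (k - a) →
        D.edgeFinset.card * k < ∑ v, deg D v * deg D v + r * (k - 1 - r) + 2 * ((T + 1) * (r - T - 2)) →
        ∃ t, t ≤ T ∧ ∃ j, 2 * j ≤ t * (t + 1) ∧
          ∑ v, deg D v * deg D v + r * (k - 1 - r) + (2 * (t * (r - t - 1)) + 2 * j) = D.edgeFinset.card * k) ∧
      (∀ t, t ≤ T → ∀ j, 2 * j ≤ t * (t + 1) →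
        ∃ (D : SimpleGraph (Fin k)) (_ : DecidableRel D.Adj), K4mFree D ∧ D.edgeFinset.card + r = a * (k - a) ∧
          ∑ v, deg D v * deg D v + r * (k - 1 - r) + (2 * (t * (r - t - 1)) + 2 * j) =
            D.edgeFinset.card * k) := by
  have hcard : Fintype.card (Fin k) = k := Fintype.card_fin k
  refine ⟨?_, ?_⟩
  · intro D _ hK hm hlt
    have hbip : ∃ A : Finset (Fin k), A.card = a ∧ BipSub D A := by
      by_contra hnb
      have h := (stab_table_rows_ge_three k a r ha3 hk (by omega) hk3).1 D hK hm hnb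
      omega
    obtain ⟨A, hA, hB⟩ := hbip
    have hH := bipSub_sum_deg_sq_add_disjEdgePairs D A hB a r hA (by rw [hcard]; exact hm) (by rw [hcard]; omega)
    rw [hcard] at hH
    have hr' : (missingGraph D A).edgeFinset.card = r :=
      card_edges_missingGraph D A hB a r hA (by rw [hcard]; exact hm)
    have hid := sum_deg_sq_add_disjEdgePairs (missingGraph D A)
    rw [hr'] at hid
    have hfree := cliqueFree_of_bipSub _ A (bipSub_missingGraph D A)
    rcases pair_count_spectrum_level (missingGraph D A) hfree T r hr4 hr' with ⟨t, ht, j, hj, h⟩ | h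
    · exact ⟨t, ht, j, hj, by omega⟩
    · omega
  · intro t ht j hj
    rcases Nat.eq_zero_or_pos t with rfl | hpos
    · have hj0 : j = 0 := by omega
      subst hj0
      have hK := k4mFree_bipMinusStar k a r
      have hE := card_edges_bipMinusStar k a r (by omega) (by omega)
      have hS := sum_deg_sq_bipMinusStar k a r (by omega) (by omega) (by omega)
      rw [hcard] at hS
      exact ⟨bipMinusStar k a r, inferInstance, hK, hE, by simpa using hS⟩
    · exact cherry_band_full k a r t hpos (by omega) (by omega) (by omega) (by omega) j hj

/-! ### The fifth band -/

/-- **THE SPECTRUM DOWN TO THE `Δ = s − 5` LAYER** (`s ≥ 28`): the star, the bands `t = 1, …, 5`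
(`j ≤ 1, 3, 6, 10, 15`), or the level-five tail `Σ d² + 12 (s − 7) ≤ s (s + 1)`. -/
theorem pair_count_spectrum_five (H : SimpleGraph V) [DecidableRel H.Adj] (hfree : H.CliqueFree 3) (s : ℕ)
    (hs : 28 ≤ s) (hm : H.edgeFinset.card = s) :
    ∑ v, deg H v * deg H v = s * (s + 1) ∨
      (∃ j, j ≤ 1 ∧ ∑ v, deg H v * deg H v + 2 * (s - 2) + 2 * j = s * (s + 1)) ∨
      (∃ j, j ≤ 3 ∧ ∑ v, deg H v * deg H v + 4 * (s - 3) + 2 * j = s * (s + 1)) ∨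
      (∃ j, j ≤ 6 ∧ ∑ v, deg H v * deg H v + 6 * (s - 4) + 2 * j = s * (s + 1)) ∨
      (∃ j, j ≤ 10 ∧ ∑ v, deg H v * deg H v + 8 * (s - 5) + 2 * j = s * (s + 1)) ∨
      (∃ j, j ≤ 15 ∧ ∑ v, deg H v * deg H v + 10 * (s - 6) + 2 * j = s * (s + 1)) ∨
      ∑ v, deg H v * deg H v + 12 * (s - 7) ≤ s * (s + 1) := by
  rcases pair_count_spectrum_level H hfree 5 s (by omega) hm with ⟨t, ht, j, hj, h⟩ | h
  · interval_cases t
    · left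
      simp only [zero_mul, mul_zero, add_zero] at h
      have : j = 0 := by omega
      subst this
      simpa using h
    · right; left
      exact ⟨j, by omega, by omega⟩
    · right; right; left
      exact ⟨j, by omega, by omega⟩
    · right; right; right; left
      exact ⟨j, by omega, by omega⟩
    · right; right; right; right; left
      exact ⟨j, by omega, by omega⟩
    · right; right; right; right; right; left
      exact ⟨j, by omega, by omega⟩
  · right; right; right; right; right; right
    omega

/-- **THE FIFTH-BAND LOCI OF THE PAIR COUNT** (`s ≥ 28`, `j ≤ 15`): `Σ h² + 10 (s − 6) + 2 j = s (s + 1)` forces a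
vertex `w` of degree `s − 5` (five off-edges) with `2·attach + offAdjPairs + 2 j = 30`. -/
theorem fifth_band_locus (H : SimpleGraph V) [DecidableRel H.Adj] (hfree : H.CliqueFree 3) (s : ℕ)
    (hs : 28 ≤ s) (hm : H.edgeFinset.card = s) (j : ℕ) (hj : j ≤ 15)
    (hS : ∑ v, deg H v * deg H v + 10 * (s - 6) + 2 * j = s * (s + 1)) :
    ∃ w, deg H w + 5 = s ∧ (offEdges H w).card = 5 ∧ 2 * attach H w + offAdjPairs H w + 2 * j = 30 := by
  have h := layer_band_locus H hfree 5 s (by norm_num) (by omega) (by omega) hm j (by omega) (by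
    have e : 2 * (5 * (s - 5 - 1)) = 10 * (s - 6) := by omega
    rw [e]
    exact hS)
  simpa using h

/-- **THE FIFTH-BAND LOCI ON THE CELL** (`3 ≤ a`, `28 ≤ r`, `2 a + r ≤ k` (`r + 7 ≤ k` at `a = 3`), `j ≤ 15`,
`10 (r − 6) + 30 < stabGapFull k a r`): a `K₄⁻`-free graph at `closed − (10 (r − 6) + 2 j)` is `a`-bipartite and its
missing graph has a vertex `w` of degree `r − 5` with `2·attach + offAdjPairs + 2 j = 30`. -/
theorem cherry_fifth_band_locus (k a r : ℕ) (ha3 : 3 ≤ a) (hr28 : 28 ≤ r) (hk : 2 * a + r ≤ k)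
    (hk3 : a = 3 → r + 7 ≤ k) (j : ℕ) (hj : j ≤ 15) (hlt : 10 * (r - 6) + 30 < stabGapFull k a r)
    (D : SimpleGraph (Fin k)) [DecidableRel D.Adj] (hK : K4mFree D) (hm : D.edgeFinset.card + r = a * (k - a))
    (heq : ∑ v, deg D v * deg D v + r * (k - 1 - r) + (10 * (r - 6) + 2 * j) = D.edgeFinset.card * k) :
    ∃ A : Finset (Fin k), A.card = a ∧ BipSub D A ∧
      ∃ w, deg (missingGraph D A) w + 5 = r ∧ (offEdges (missingGraph D A) w).card = 5 ∧
        2 * attach (missingGraph D A) w + offAdjPairs (missingGraph D A) w + 2 * j = 30 := by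
  have e : 2 * (5 * (r - 5 - 1)) = 10 * (r - 6) := by omega
  have h := cherry_band_locus_level k a r 5 ha3 (by norm_num) (by omega) (by omega) hk hk3 j (by omega)
    (by rw [e]; norm_num; omega) D hK hm (by rw [e]; exact heq)
  simpa using h

/-- **THE FIRST FIVE LAYERS OF THE CHERRY TABLE — THE FORTY-ONE VALUES, BAND FORM** (`6 ≤ a`, `28 ≤ r`,
`2 a + r ≤ k`, `12 (r − 7) ≤ stabGapFull k a r`): a `K₄⁻`-free graph strictly within `12 (r − 7)` of the closed form
sits at a band value `closed − (2 t (r − t − 1) + 2 j)` with `t ≤ 5`, `2 j ≤ t (t + 1)` (`1 + 2 + 4 + 7 + 11 + 16 = 41`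
values), and each is attained. -/
theorem cherry_top_five_layers (k a r : ℕ) (ha6 : 6 ≤ a) (hr28 : 28 ≤ r) (hk : 2 * a + r ≤ k)
    (hgap : 12 * (r - 7) ≤ stabGapFull k a r) :
    (∀ (D : SimpleGraph (Fin k)) [DecidableRel D.Adj], K4mFree D → D.edgeFinset.card + r = a * (k - a) →
        D.edgeFinset.card * k < ∑ v, deg D v * deg D v + r * (k - 1 - r) + 12 * (r - 7) →
        ∃ t, t ≤ 5 ∧ ∃ j, 2 * j ≤ t * (t + 1) ∧
          ∑ v, deg D v * deg D v + r * (k - 1 - r) + (2 * (t * (r - t - 1)) + 2 * j) = D.edgeFinset.card * k) ∧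
      (∀ t, t ≤ 5 → ∀ j, 2 * j ≤ t * (t + 1) →
        ∃ (D : SimpleGraph (Fin k)) (_ : DecidableRel D.Adj), K4mFree D ∧ D.edgeFinset.card + r = a * (k - a) ∧
          ∑ v, deg D v * deg D v + r * (k - 1 - r) + (2 * (t * (r - t - 1)) + 2 * j) =
            D.edgeFinset.card * k) := by
  have e : 2 * ((5 + 1) * (r - 5 - 2)) = 12 * (r - 7) := by omega
  have h := cherry_top_layers k a r 5 (by omega) ha6 (by omega) (by omega) hk (by omega) (by rw [e]; exact hgap)
  rw [e] at h
  exact h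

/-- `stabGapFull k a r ≥ 12 (r − 7)` for `3 ≤ a`, `1 ≤ r`, `2 a + 6 r ≤ k`. -/
theorem stabGapFull_ge_twelve (k a r : ℕ) (ha3 : 3 ≤ a) (hr : 1 ≤ r) (hk : 2 * a + 6 * r ≤ k) :
    12 * (r - 7) ≤ stabGapFull k a r := by
  unfold stabGapFull
  by_cases h1 : r + 3 ≤ a
  · rw [if_pos h1]
    have hb1 : 6 * r - 1 ≤ k - 2 * a - 1 := by omega
    have hb2 : 3 ≤ a - r := by omega
    have := Nat.mul_le_mul (Nat.mul_le_mul_left 2 hb1) hb2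
    omega
  · rw [if_neg h1]
    by_cases h2 : r + 1 ≤ a
    · rw [if_pos h2]
      omega
    · rw [if_neg h2]
      apply le_min
      · have : 0 ≤ 2 * (r - a) * (a - 2) := Nat.zero_le _
        omega
      · have : 0 ≤ 2 * (r - a) * (a - 3) := Nat.zero_le _
        omega

/-- **THE FIRST FIVE LAYERS FOR `2 a + 6 r ≤ k`** (`6 ≤ a`, `28 ≤ r`). -/
theorem cherry_top_five_layers_of_k (k a r : ℕ) (ha6 : 6 ≤ a) (hr28 : 28 ≤ r) (hk : 2 * a + 6 * r ≤ k) :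
    (∀ (D : SimpleGraph (Fin k)) [DecidableRel D.Adj], K4mFree D → D.edgeFinset.card + r = a * (k - a) →
        D.edgeFinset.card * k < ∑ v, deg D v * deg D v + r * (k - 1 - r) + 12 * (r - 7) →
        ∃ t, t ≤ 5 ∧ ∃ j, 2 * j ≤ t * (t + 1) ∧
          ∑ v, deg D v * deg D v + r * (k - 1 - r) + (2 * (t * (r - t - 1)) + 2 * j) = D.edgeFinset.card * k) ∧
      (∀ t, t ≤ 5 → ∀ j, 2 * j ≤ t * (t + 1) →
        ∃ (D : SimpleGraph (Fin k)) (_ : DecidableRel D.Adj), K4mFree D ∧ D.edgeFinset.card + r = a * (k - a) ∧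
          ∑ v, deg D v * deg D v + r * (k - 1 - r) + (2 * (t * (r - t - 1)) + 2 * j) =
            D.edgeFinset.card * k) :=
  cherry_top_five_layers k a r ha6 hr28 (by omega) (stabGapFull_ge_twelve k a r (by omega) (by omega) hk)

end C047

end TriangleCap

end PercRepro
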